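import Literature.Computability.QuantumComplexity.SymExecCodeFP
import HarnessLib

/-!
# Exact amplitudes of `T`-free Clifford+`T` gate lists in polynomial time (Gottesman–Knill, strong form)

Topic `Literature/Computability/QuantumComplexity`, sub-namespace `BravyiGosset` (the path-sum /
Gauss-sum line of files of the Bravyi–Gosset discharge); third support file for the discharge of
`MehrabanTahmasbi2024_PSharpP_subset_PPoly_of_stabilizerRank_poly` (`StabilizerRankPermanent.lean`),
whose printed proof (Mehraban–Tahmasbi, arXiv:2305.10277, p. 6) computes each
`⟨0ⁿ 1 0^m| C_f (|0^{n+1}⟩ ⊗ φᵢ)⟩` "using the Gottesman–Knill algorithm … in polynomial time".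
Here: for an oracle-free, `T`-free gate list `U` on `N` wires and basis labels `y`, `z`, the amplitude
`⟨z|U|y⟩` is EXACTLY `(1/√2)^h (1/2)^N Γ`, where `Γ ∈ ℤ[i]` is ONE exponential sum of a quadratic
form (`CliffordGaussSums.lean`): symbolic execution (`CliffordTSymbolicPaths.lean`) followed by `N`
output constraints `[label_j(w) = z_j]`, each written as `½ Σ_s (-1)^{s (form_j(w) ⊕ z_j)}` with a
fresh variable `s` (`augAll`, generalising the single constraint `augOut` of
`BravyiGossetPairData.lean`), evaluated by `GData.gaussEval`; and the whole map
`(gate codes, y, z) ↦ Γ` is computed on codes by a polynomial-time string function (`ampVal_codeFP`,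
typed `CodeFP` facts over `SymExecCodeFP.lean`, `GaussCodeFP.lean`; no machine is written).

* `augAllAt`, `augAll`, `val_augAll`, **`gsum_augAll`** (`Γ = 2^N Σ_u [label(u) = z] i^{…}(-1)^{…}`);
* **`amplitude_eq_gaussEval`**: `⟨z|U|y⟩ = (1/√2)^h (1/2)^N · gaussEval …` for `T`-free `U`;
* `exists_gaussInt_amplitude`: `√2^h ⟨z|U|y⟩` is a Gaussian integer with coordinates `≤ 2^h`;
* the code layer: `AT = gate codes × (y, z)`, `stateOf`, `ampValOf`, **`ampVal_codeFP`**, and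
  **`ampValOf_spec`** tying the coded value to the amplitude.

## References

* D. Gottesman, *The Heisenberg representation of quantum computers*, arXiv:quant-ph/9807006 (1998);
  S. Aaronson, D. Gottesman, PRA 70 (2004) 052328, §III (strong simulation of stabilizer circuits).
* S. Bravyi, D. Gosset, PRL 116 (2016) 250501, App. A–C (amplitudes of Clifford circuits as
  exponential sums of quadratic forms, evaluated in `O(k³)`).
* M. Van den Nest, Quantum Inf. Comput. 10 (2010) 258, §3.
* S. Mehraban, M. Tahmasbi, arXiv:2305.10277 (STOC 2024), proof of Thm. 1.6.
-/

noncomputable section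

namespace Literature.Computability.QuantumComplexity.BravyiGosset

open Complex Finset _root_.Computability Literature.Computability.Complexity Literature.Computability.Complexity.CodeFP
  Literature.Computability.Cryptography Matrix

/-! ### All output constraints -/

/-- Constraint `j`: multiply by `(-1)^{s_j · (form_j(w) ⊕ z_j)}` on the fresh variable `s_j = w_{h+j}`.
[cite: BravyiGosset2016, App. C (inner products as exponential sums)] -/
def augAllAt (h : ℕ) (σ : SymState) (z : List Bool) (D : GData) (j : ℕ) : GData :=
  GData.addQuadProduct (AffForm.unit (h + j)) ((σ.form j).addConst (z.getD j false)) D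

/-- All `N` constraints, in order. [cite: BravyiGosset2016, App. C] -/
def augAll (h N : ℕ) (σ : SymState) (z : List Bool) (D : GData) : GData := (List.range N).foldl (augAllAt h σ z) D

/-- One more constraint. [folklore] -/
theorem augAll_succ (h N : ℕ) (σ : SymState) (z : List Bool) (D : GData) :
    augAll h (N + 1) σ z D = augAllAt h σ z (augAll h N σ z D) N := by
  rw [augAll, List.range_succ, List.foldl_append, List.foldl_cons, List.foldl_nil, ← augAll]

/-- **Value of the constrained data**:
`D'(w) = D(w) · Π_{j<N} (-1)^{[w_{h+j} ∧ (form_j(w) ⊕ z_j)]}`. [cite: BravyiGosset2016, App. C] -/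
theorem val_augAll {V : ℕ} (h : ℕ) (σ : SymState) (z : List Bool) (w : Fin V → Bool) :
    ∀ (N : ℕ), h + N ≤ V → ∀ D : GData, (augAll h N σ z D).val V w =
      D.val V w * ∏ j ∈ range N, (-1 : ℂ) ^ Bool.toNat (wbit w (h + j) && ((σ.form j).eval w ^^ z.getD j false))
  | 0, _, D => by simp [augAll]
  | N + 1, hV, D => by
    rw [augAll_succ, augAllAt, GData.val_addQuadProduct, val_augAll h σ z w N (by omega) D, Finset.prod_range_succ,
      AffForm.eval_unit (h + N) (by omega), AffForm.eval_addConst, wbit_of_lt w (by omega : h + N < V), mul_assoc]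

/-- Products of `1 + (-1)^{[c_j]}`: `2^N` if no `c_j` holds, else `0`. [folklore] -/
theorem prod_one_add_neg_one_pow (N : ℕ) (c : ℕ → Bool) :
    ∏ j ∈ range N, ((1 : ℂ) + (-1 : ℂ) ^ Bool.toNat (c j)) = if (∀ j < N, c j = false) then (2 : ℂ) ^ N else 0 := by
  induction N with
  | zero => simp
  | succ N ih =>
    rw [Finset.prod_range_succ, ih]
    by_cases hall : ∀ j < N, c j = false
    · rw [if_pos hall]
      cases hc : c N
      · rw [if_pos (fun j hj => by rcases Nat.lt_succ_iff_lt_or_eq.1 hj with hj | rfl <;> [exact hall j hj; exact hc])]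
        simp [pow_succ]; ring
      · rw [if_neg (fun h => by have := h N (Nat.lt_succ_self N); rw [hc] at this; exact Bool.noConfusion this)]
        simp
    · rw [if_neg hall, zero_mul, if_neg (fun h => hall fun j hj => h j (Nat.lt_succ_of_lt hj))]

/-- **The exponential sum of the constrained data.** With `h = nv` and `σ` satisfying `Supp`:
`Γ_{h+N}(augAll) = 2^N Σ_{u ∈ 𝔽₂^h} [∀ j<N, form_j(u) = z_j] · D(u)`. [cite: BravyiGosset2016, App. C] -/
theorem gsum_augAll (N : ℕ) (σ : SymState) (hσ : σ.Supp) (z : List Bool) :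
    GData.gsum (σ.nv + N) (augAll σ.nv N σ z σ.D) =
      (2 : ℂ) ^ N * ∑ u : Fin σ.nv → Bool,
        if (∀ j < N, (σ.form j).eval u = z.getD j false) then σ.D.val σ.nv u else 0 := by
  set h := σ.nv with hh
  unfold GData.gsum
  rw [← (Fin.appendEquiv h N).sum_comp, Fintype.sum_prod_type, Finset.mul_sum]
  refine Finset.sum_congr rfl fun u _ => ?_
  have happ : ∀ s : Fin N → Bool, (Fin.appendEquiv h N) (u, s) = Fin.append u s := fun _ => rfl
  simp only [happ]
  have hagree : ∀ (s : Fin N → Bool) (j : ℕ), j < h → wbit (Fin.append u s) j = wbit u j := by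
    intro s j hj; rw [wbit_append, if_pos hj]
  have hform : ∀ (s : Fin N → Bool) (j : ℕ), (σ.form j).eval (Fin.append u s) = (σ.form j).eval u :=
    fun s j => AffForm.eval_eq_of_agree _ (fun p hp => (hσ p hp).1 j) (hagree s)
  have hval : ∀ s : Fin N → Bool, σ.D.val (h + N) (Fin.append u s) = σ.D.val h u :=
    fun s => GData.val_eq_of_agree σ.D (fun p hp => (hσ p hp).2.2) (hagree s)
  have hbit : ∀ (s : Fin N → Bool) (j : ℕ), wbit (Fin.append u s) (h + j) = wbit s j := by
    intro s j; rw [wbit_append, if_neg (by omega), Nat.add_sub_cancel_left]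
  set c : ℕ → Bool := fun j => ((σ.form j).eval u ^^ z.getD j false) with hc
  set G : ℕ → Bool → ℂ := fun j b => (-1 : ℂ) ^ Bool.toNat (b && c j) with hG
  have hsummand : ∀ s : Fin N → Bool,
      (augAll h N σ z σ.D).val (h + N) (Fin.append u s) = σ.D.val h u * ∏ j ∈ range N, G j (wbit s j) := by
    intro s
    rw [val_augAll h σ z (Fin.append u s) N le_rfl σ.D, hval]
    congr 1
    exact Finset.prod_congr rfl fun j _ => by rw [hbit, hform]
  rw [Finset.sum_congr rfl fun s _ => hsummand s, ← Finset.mul_sum, sum_prod_wbit]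
  simp only [hG, Bool.false_and, Bool.toNat_false, pow_zero, Bool.true_and]
  rw [prod_one_add_neg_one_pow]
  have hxor : ∀ a b : Bool, ((a ^^ b) = false ↔ a = b) := by decide
  have hiff : (∀ j < N, c j = false) ↔ ∀ j < N, (σ.form j).eval u = z.getD j false := by
    simp only [hc, hxor]
  by_cases hz : ∀ j < N, (σ.form j).eval u = z.getD j false
  · rw [if_pos (hiff.2 hz), if_pos hz, mul_comm]
  · rw [if_neg (fun h' => hz (hiff.1 h')), if_neg hz, mul_zero, mul_zero]

/-! ### The amplitude of a `T`-free gate list as one Gauss sum -/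

section Amplitude

variable {N : ℕ}

/-- The variable counter after symbolic execution counts the Hadamard gates. [folklore] -/
theorem nv_exec_map_toSymGate (l : List (QGate cliffordT N)) (τ : SymState) :
    (SymState.exec (l.map toSymGate) τ).nv = τ.nv + hCount l := by
  induction l generalizing τ with
  | nil => simp
  | cons g l ih =>
    rw [List.map_cons, SymState.exec_cons, ih, SymState.nv_step, hCount_cons]
    cases g with
    | oracle k e => simp [toSymGate, QGateIsH]
    | gate op e => cases op <;> simp [toSymGate, QGateIsH]; omega

/-- A `T`-free gate list records no `T` forms. [folklore] -/
theorem tforms_exec_map_toSymGate (l : List (QGate cliffordT N)) (hT : ∀ g ∈ l, g.isT = false) (τ : SymState) :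
    (SymState.exec (l.map toSymGate) τ).tforms = τ.tforms := by
  induction l generalizing τ with
  | nil => rfl
  | cons g l ih =>
    rw [List.map_cons, SymState.exec_cons, ih (fun g' hg' => hT g' (List.mem_cons_of_mem _ hg'))]
    have hg := hT g List.mem_cons_self
    cases g with
    | oracle k e => rfl
    | gate op e => cases op <;> first | rfl | exact absurd hg (by simp)

/-- With no `T` forms the phase of a path is the Clifford phase. [folklore] -/
theorem phase_eq_val_of_tforms_nil {V : ℕ} (σ : SymState) (h : σ.tforms = []) (w : Fin V → Bool) :
    σ.phase V w = σ.D.val V w := by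
  rw [SymState.phase, SymState.tcount, h]; simp

/-- Label agreement, bit by bit through a list of target bits. [folklore] -/
theorem label_eq_iff_forall {V : ℕ} (σ : SymState) (u : Fin V → Bool) (z : QReg N) :
    σ.label N u = z ↔ ∀ j < N, (σ.form j).eval u = (List.ofFn z).getD j false := by
  constructor
  · intro h j hj
    rw [List.getD_eq_getElem _ _ (by simpa using hj), List.getElem_ofFn]
    exact congrFun h ⟨j, hj⟩
  · intro h
    funext j
    have := h j j.2
    rwa [List.getD_eq_getElem _ _ (by simp), List.getElem_ofFn] at this

/-- **The amplitude of a `T`-free gate list is one Gauss sum** (strong Gottesman–Knill): with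
`σ' = execGates U (init y)`, `h = hCount U`,
`⟨z|U|y⟩ = (1/√2)^h (1/2)^N · Γ_{h+N}(augAll h N σ' z σ'.D)`.
[cite: AaronsonGottesman2004, §III] -/
theorem amplitude_eq_gsum (gs : List (QGate cliffordT N)) (hgs : ∀ g ∈ gs, g.IsOracleFree)
    (hT : ∀ g ∈ gs, g.isT = false) (y z : QReg N) :
    (prodZeta omega gs *ᵥ basisState y) z =
      invSqrt2 ^ hCount gs * (1 / 2 : ℂ) ^ N *
        GData.gsum ((SymState.execGates gs (SymState.init y)).nv + N)
          (augAll (SymState.execGates gs (SymState.init y)).nv N (SymState.execGates gs (SymState.init y))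
            (List.ofFn z) (SymState.execGates gs (SymState.init y)).D) := by
  set σ := SymState.execGates gs (SymState.init y) with hσdef
  have hσ : σ.Supp := (SymState.supp_init y).exec _
  have hnv : σ.nv = hCount gs := by
    show (SymState.exec (gs.map toSymGate) (SymState.init y)).nv = hCount gs
    rw [nv_exec_map_toSymGate]; show 0 + hCount gs = hCount gs; rw [Nat.zero_add]
  have htf : σ.tforms = [] := by
    show (SymState.exec (gs.map toSymGate) (SymState.init y)).tforms = []
    rw [tforms_exec_map_toSymGate gs hT]; rfl
  rw [gsum_augAll N σ hσ, ← mul_assoc (invSqrt2 ^ hCount gs * (1 / 2 : ℂ) ^ N), mul_assoc (invSqrt2 ^ hCount gs),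
    ← mul_pow, show (1 / 2 : ℂ) * 2 = 1 by norm_num, one_pow, mul_one,
    SymState.prodZeta_apply_eq_sum gs hgs (le_of_eq hnv.symm) y z (fun _ => false), hnv]
  congr 1
  refine Finset.sum_congr rfl fun v _ => ?_
  rw [show SymState.execGates gs (SymState.init y) = σ from rfl, SymState.ovr_self, phase_eq_val_of_tforms_nil σ htf]
  exact if_congr (label_eq_iff_forall σ v z) rfl rfl

/-- Values of quadratic-form data are powers of `i`. [folklore] -/
theorem val_eq_I_pow {k : ℕ} (D : GData) (w : Fin k → Bool) : D.val k w = I ^ (D.expI w + 2 * D.expNeg w) := by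
  rw [GData.val, pow_add, I_pow_two_mul]

/-- `i^e` as a Gaussian integer has coordinates of absolute value at most `1`. [folklore] -/
theorem natAbs_iPowZi_le (e : ℕ) : (iPowZi e).re.natAbs ≤ 1 ∧ (iPowZi e).im.natAbs ≤ 1 := by
  unfold iPowZi
  split_ifs <;> simp

/-- A finite sum of powers of `i` is a Gaussian integer with coordinates bounded by the number of
terms. [folklore] -/
theorem exists_gaussInt_of_sum_I_pow {ι : Type*} (s : Finset ι) (e : ι → ℕ) :
    ∃ g : GaussianInt, (g : ℂ) = ∑ i ∈ s, I ^ e i ∧ g.re.natAbs ≤ s.card ∧ g.im.natAbs ≤ s.card := by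
  classical
  induction s using Finset.induction_on with
  | empty => exact ⟨0, by simp, by simp, by simp⟩
  | insert a s ha ih =>
    obtain ⟨g, hg, hre, him⟩ := ih
    refine ⟨iPowZi (e a) + g, ?_, ?_, ?_⟩
    · rw [Finset.sum_insert ha, GaussianInt.toComplex_add, toComplex_iPowZi, hg]
    · rw [Finset.card_insert_of_notMem ha, Zsqrtd.re_add]
      have := (natAbs_iPowZi_le (e a)).1
      have := Int.natAbs_add_le (iPowZi (e a)).re g.re
      omega
    · rw [Finset.card_insert_of_notMem ha, Zsqrtd.im_add]
      have := (natAbs_iPowZi_le (e a)).2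
      have := Int.natAbs_add_le (iPowZi (e a)).im g.im
      omega

/-- **Integrality of scaled amplitudes**: for a `T`-free oracle-free gate list with `h` Hadamard
gates, `√2^h ⟨z|U|y⟩` is a Gaussian integer whose coordinates are at most `2^h` in absolute value
(a signed sum over at most `2^h` paths of phases `±1, ±i`). [cite: BravyiGosset2016, §II (path sums)] -/
theorem exists_gaussInt_amplitude (gs : List (QGate cliffordT N)) (hgs : ∀ g ∈ gs, g.IsOracleFree)
    (hT : ∀ g ∈ gs, g.isT = false) (y z : QReg N) :
    ∃ g : GaussianInt, (g : ℂ) = invSqrt2⁻¹ ^ hCount gs * (prodZeta omega gs *ᵥ basisState y) z ∧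
      g.re.natAbs ≤ 2 ^ hCount gs ∧ g.im.natAbs ≤ 2 ^ hCount gs := by
  classical
  set σ := SymState.execGates gs (SymState.init y) with hσdef
  have hnv : σ.nv = hCount gs := by
    show (SymState.exec (gs.map toSymGate) (SymState.init y)).nv = hCount gs
    rw [nv_exec_map_toSymGate]; show 0 + hCount gs = hCount gs; rw [Nat.zero_add]
  have htf : σ.tforms = [] := by
    show (SymState.exec (gs.map toSymGate) (SymState.init y)).tforms = []
    rw [tforms_exec_map_toSymGate gs hT]; rfl
  have hamp : (prodZeta omega gs *ᵥ basisState y) z =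
      invSqrt2 ^ hCount gs * ∑ u ∈ Finset.univ.filter (fun u : Fin (hCount gs) → Bool => σ.label N u = z),
        I ^ (σ.D.expI u + 2 * σ.D.expNeg u) := by
    rw [SymState.prodZeta_apply_eq_sum gs hgs le_rfl y z (fun _ => false), Finset.sum_filter]
    congr 1
    refine Finset.sum_congr rfl fun v _ => ?_
    rw [show SymState.execGates gs (SymState.init y) = σ from rfl, SymState.ovr_self]
    split_ifs
    · rw [phase_eq_val_of_tforms_nil σ htf, val_eq_I_pow]
    · rfl
  obtain ⟨g, hg, hre, him⟩ := exists_gaussInt_of_sum_I_pow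
    (Finset.univ.filter (fun u : Fin (hCount gs) → Bool => σ.label N u = z)) (fun u => σ.D.expI u + 2 * σ.D.expNeg u)
  have hcard : (Finset.univ.filter (fun u : Fin (hCount gs) → Bool => σ.label N u = z)).card ≤ 2 ^ hCount gs :=
    (Finset.card_filter_le _ _).trans (by rw [Finset.card_univ, Fintype.card_fun, Fintype.card_bool, Fintype.card_fin])
  have hne : invSqrt2 ≠ 0 := one_div_ne_zero (by exact_mod_cast (Real.sqrt_pos.2 (by norm_num : (0 : ℝ) < 2)).ne')
  refine ⟨g, ?_, hre.trans hcard, him.trans hcard⟩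
  rw [hamp, ← mul_assoc, ← mul_pow, inv_mul_cancel₀ hne, one_pow, one_mul, hg]

end Amplitude

/-! ### The code layer: amplitude tasks -/

/-- **Amplitude tasks**: the gate codes of a gate list and the two basis labels `(y, z)` as bit lists.
[folklore] -/
abbrev AT : Type := List GateCode × (List Bool × List Bool)

/-- The code of an amplitude task. [folklore] -/
def atE : AT → List Bool := pairE (rawE gcE) (pairE bitsE bitsE)

/-- The initial symbolic state of a bit list: constant forms, no phase, no variables. [folklore] -/
def initL (y : List Bool) : SymState := ⟨y.map AffForm.const, ⟨0, [], []⟩, [], 0⟩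

/-- `SymState.init y = initL (ofFn y)`. [folklore] -/
theorem init_eq_initL {N : ℕ} (y : QReg N) : SymState.init y = initL (List.ofFn y) := by
  unfold SymState.init initL
  congr 1
  rw [List.map_ofFn]
  rfl

/-- **The symbolic state of a task**: fold the steps of the gate codes from `initL y`. [folklore] -/
def stateOf (t : AT) : SymState := t.1.foldl (fun σ gc => SymState.step (symOfCode gc) σ) (initL t.2.1)

/-- Symbolic execution of a gate list is `stateOf` of its task. [folklore] -/
theorem execGates_eq_stateOf {N : ℕ} (gs : List (QGate cliffordT N)) (y : QReg N) (zl : List Bool) :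
    SymState.execGates gs (SymState.init y) = stateOf (gs.map gateTriple, (List.ofFn y, zl)) := by
  rw [init_eq_initL]
  unfold SymState.execGates SymState.exec stateOf
  simp only [List.foldl_map, symOfCode_gateTriple]

/-- The number of Gauss-sum variables of a task: Hadamard variables and one per output wire. [folklore] -/
def numVOf (t : AT) : ℕ := (stateOf t).nv + t.2.1.length

/-- The constrained Gauss data of a task. [cite: BravyiGosset2016, App. C] -/
def ampDataOf (t : AT) : GData := augAll (stateOf t).nv t.2.1.length (stateOf t) t.2.2 (stateOf t).D

/-- **The value of a task**: the exponential sum of the (sanitised) constrained data, a Gaussian integer.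
[cite: BravyiGosset2016, App. A (ExponentialSum)] -/
def ampValOf (t : AT) : GaussianInt := GData.gaussEval (numVOf t) (GData.sanitize (numVOf t) (ampDataOf t))

/-! ### Shapes -/

/-- The initial state of a bit list is shaped. [folklore] -/
theorem shaped_initL (y : List Bool) : (initL y).Shaped y.length 0 := by
  refine ⟨by simp [initL], ?_, ?_, ?_, le_rfl, by simp [initL]⟩
  · intro f hf
    simp only [initL, List.mem_map] at hf
    obtain ⟨b, _, rfl⟩ := hf
    simp [AffForm.const]
  · simp [initL]
  · exact ⟨by simp [initL], by simp [initL], by simp [initL], by simp [initL], by simp [initL]⟩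

/-- The state of a task is shaped. [folklore] -/
theorem shaped_stateOf (t : AT) : (stateOf t).Shaped t.2.1.length t.1.length := by
  have h := (shaped_initL t.2.1).foldl t.1
  rwa [Nat.zero_add] at h

/-- The coefficient list of a unit form. [folklore] -/
theorem length_unit_a (i : ℕ) : (AffForm.unit i).a.length = i + 1 := by simp [AffForm.unit]

/-- Constraints keep the data sized (bound `K ≥ nv + j + 1` for every constrained wire `j`). [folklore] -/
theorem sized_foldl_augAllAt {K : ℕ} (σ : SymState) (z : List Bool) (hform : ∀ j, (σ.form j).a.length ≤ K) :
    ∀ (l : List ℕ) (D : GData), D.Sized K → (∀ j ∈ l, σ.nv + j + 1 ≤ K) → (l.foldl (augAllAt σ.nv σ z) D).Sized K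
  | [], D, hD, _ => hD
  | j :: l, D, hD, hl => by
    rw [List.foldl_cons]
    refine sized_foldl_augAllAt σ z hform l _ ?_ (fun j' hj' => hl j' (List.mem_cons_of_mem _ hj'))
    exact hD.addQuadProduct (by rw [length_unit_a]; exact hl j List.mem_cons_self) (hform j)

/-- The constrained data of a task are sized by the number of variables. [folklore] -/
theorem sized_ampDataOf (t : AT) : (ampDataOf t).Sized (numVOf t) := by
  obtain ⟨h1, h2, h3, h4, h5, h6⟩ := shaped_stateOf t
  unfold ampDataOf augAll numVOf
  refine sized_foldl_augAllAt (stateOf t) t.2.2 (fun j => (SymState.length_form_le h2 j).trans (Nat.le_add_right _ _))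
    (List.range t.2.1.length) _ (h4.mono (Nat.le_add_right _ _)) (fun j hj => ?_)
  have := List.mem_range.1 hj; omega

/-- Hence the sanitisation inside `ampValOf` does nothing. [folklore] -/
theorem ampValOf_eq (t : AT) : ampValOf t = GData.gaussEval (numVOf t) (ampDataOf t) := by
  rw [ampValOf, GData.sanitize_eq_self (sized_ampDataOf t)]

/-! ### `CodeFP` facts -/

/-- `initL` on codes. [folklore] -/
theorem initL_codeFP : CodeFP bitsE stE initL := by
  have hforms : CodeFP bitsE formsE (fun y => y.map AffForm.const) := map₀ affConst
  exact (stMk.comp (hforms.pair ((const _ (⟨0, [], []⟩ : GData)).pair ((const _ ([] : List AffForm)).pair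
    (const _ (0 : ℕ)))))).congr fun _ => rfl

/-- **`stateOf` on codes** (a polynomially bounded fold of `stepCode`). [cite: AroraBarak2009, §1.3; BravyiGosset2016, §II] -/
theorem stateOf_codeFP : CodeFP atE stE stateOf := by
  have hstep : CodeFP (pairE atE (pairE gcE stE)) stE (fun t => SymState.step (symOfCode t.2.1) t.2.2) :=
    stepCode_codeFP.comp (((snd atE (pairE gcE stE)).snd').pair ((snd atE (pairE gcE stE)).fst'))
  have hinit : CodeFP atE stE (fun t => initL t.2.1) := initL_codeFP.comp ((snd _ _).fst')
  have h := foldl (σ := AT) (α := GateCode) (β := SymState) (eσ := atE) (eα := gcE) (eβ := stE)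
    (step := fun _ gc σ => SymState.step (symOfCode gc) σ) (init := fun t => initL t.2.1) hstep hinit
    (160 * (Polynomial.X + 1) ^ 3) (fun t l₁ l₂ => ?_)
  · exact (h.comp ((CodeFP.id atE).pair (fst _ _))).congr fun _ => rfl
  · have hsh := (shaped_initL t.2.1).foldl l₁
    rw [Nat.zero_add] at hsh
    refine hsh.length_stE_le.trans ?_
    simp only [Polynomial.eval_mul, Polynomial.eval_pow, Polynomial.eval_add, Polynomial.eval_X,
      Polynomial.eval_one, Polynomial.eval_ofNat]
    apply Nat.mul_le_mul_left
    apply Nat.pow_le_pow_left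
    show t.2.1.length + l₁.length + 1 ≤ (boolPair (atE t) (rawE gcE (l₁ ++ l₂))).length + 1
    rw [length_boolPair]
    have e1 : t.2.1.length ≤ (atE t).length := by
      show _ ≤ (boolPair (rawE gcE t.1) (boolPair (bitsE t.2.1) (bitsE t.2.2))).length
      rw [length_boolPair, length_boolPair]
      have : t.2.1.length ≤ (bitsE t.2.1).length := length_le_length_rawE bitE t.2.1
      omega
    have e2 := length_le_length_rawE gcE (l₁ ++ l₂)
    rw [List.length_append] at e2
    omega

/-- The capped constraint step of the code layer (equal to `augAllAt` on the wires `< |y|`). [folklore] -/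
def stepC (t : AT) (j : ℕ) (D : GData) : GData :=
  augAllAt (stateOf t).nv (stateOf t) t.2.2 D (min j t.2.1.length)

/-- On `range |y|` the capped fold is the constrained data. [folklore] -/
theorem foldl_stepC_eq (t : AT) :
    (List.range t.2.1.length).foldl (fun D j => stepC t j D) (stateOf t).D = ampDataOf t := by
  unfold ampDataOf augAll
  apply List.foldl_ext
  intro D j hj
  rw [stepC, min_eq_left (List.mem_range.1 hj).le]

/-- The capped constraint step on codes. [cite: BravyiGosset2016, App. C] -/
theorem stepC_codeFP : CodeFP (pairE atE (pairE natE gdE)) gdE (fun u => stepC u.1 u.2.1 u.2.2) := by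
  have hT : CodeFP (pairE atE (pairE natE gdE)) atE (fun u => u.1) := fst _ _
  have hJ : CodeFP (pairE atE (pairE natE gdE)) natE (fun u => u.2.1) := (snd _ _).fst'
  have hD : CodeFP (pairE atE (pairE natE gdE)) gdE (fun u => u.2.2) := (snd _ _).snd'
  have hσ : CodeFP (pairE atE (pairE natE gdE)) stE (fun u => stateOf u.1) := stateOf_codeFP.comp hT
  have hY : CodeFP (pairE atE (pairE natE gdE)) bitsE (fun u => u.1.2.1) := ((snd _ _).fst').comp hT
  have hZ : CodeFP (pairE atE (pairE natE gdE)) bitsE (fun u => u.1.2.2) := ((snd _ _).snd').comp hT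
  have hNu : CodeFP (pairE atE (pairE natE gdE)) unE (fun u => u.1.2.1.length) := (ulength bitE).comp hY
  have hju : CodeFP (pairE atE (pairE natE gdE)) unE (fun u => min u.2.1 u.1.2.1.length) := unOfNatMin.comp (hNu.pair hJ)
  have hjn : CodeFP (pairE atE (pairE natE gdE)) natE (fun u => min u.2.1 u.1.2.1.length) := natOfUn.comp hju
  have hnv : CodeFP (pairE atE (pairE natE gdE)) unE (fun u => (stateOf u.1).nv) := stNv.comp hσ
  have hunit : CodeFP (pairE atE (pairE natE gdE)) affE (fun u => AffForm.unit ((stateOf u.1).nv + min u.2.1 u.1.2.1.length)) :=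
    affUnit.comp (unAdd.comp (hnv.pair hju))
  have hzb : CodeFP (pairE atE (pairE natE gdE)) bitE (fun u => u.1.2.2.getD (min u.2.1 u.1.2.1.length) false) := by
    exact ((rawGetOr bitE).comp (hZ.pair (hjn.pair (const _ false))) :)
  have hform : CodeFP (pairE atE (pairE natE gdE)) affE
      (fun u => ((stateOf u.1).form (min u.2.1 u.1.2.1.length)).addConst (u.1.2.2.getD (min u.2.1 u.1.2.1.length) false)) :=
    affAddConst.comp ((formAt.comp (hσ.pair hjn)).pair hzb)
  exact (addQuadProduct_codeFP.comp (hunit.pair (hform.pair hD))).congr fun _ => rfl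

/-- **The constrained data on codes** (a fold over `range |y|`, sized by `nv + |y| + 1`). [cite: BravyiGosset2016, App. C] -/
theorem ampDataOf_codeFP : CodeFP atE gdE ampDataOf := by
  have hinit : CodeFP atE gdE (fun t => (stateOf t).D) := stD.comp stateOf_codeFP
  have h := foldl (σ := AT) (α := ℕ) (β := GData) (eσ := atE) (eα := natE) (eβ := gdE)
    (step := stepC) (init := fun t => (stateOf t).D) stepC_codeFP hinit (40 * (Polynomial.X + 2) ^ 2) (fun t l₁ l₂ => ?_)
  · have hr : CodeFP atE (rawE natE) (fun t => List.range t.2.1.length) := urange.comp ((ulength bitE).comp (snd _ _).fst')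
    exact (h.comp ((CodeFP.id atE).pair hr)).congr fun t => foldl_stepC_eq t
  · obtain ⟨h1, h2, h3, h4, h5, h6⟩ := shaped_stateOf t
    set K := (stateOf t).nv + t.2.1.length + 1 with hK
    have hsz : (l₁.foldl (fun D j => stepC t j D) (stateOf t).D).Sized K := by
      have e : (l₁.foldl (fun D j => stepC t j D) (stateOf t).D) =
          (l₁.map fun j => min j t.2.1.length).foldl (augAllAt (stateOf t).nv (stateOf t) t.2.2) (stateOf t).D := by
        rw [List.foldl_map]; rfl
      rw [e]
      refine sized_foldl_augAllAt (stateOf t) t.2.2 (fun j => (SymState.length_form_le h2 j).trans (by omega)) _ _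
        (h4.mono (by omega)) (fun j hj => ?_)
      obtain ⟨j', -, rfl⟩ := List.mem_map.1 hj
      have := min_le_right j' t.2.1.length; omega
    refine (GData.length_gdE_le hsz).trans ?_
    have hKle : K ≤ (boolPair (atE t) (rawE natE (l₁ ++ l₂))).length + 1 := by
      rw [length_boolPair]
      have e1 : t.2.1.length + t.1.length ≤ (atE t).length := by
        show _ ≤ (boolPair (rawE gcE t.1) (boolPair (bitsE t.2.1) (bitsE t.2.2))).length
        rw [length_boolPair, length_boolPair]
        have : t.2.1.length ≤ (bitsE t.2.1).length := length_le_length_rawE bitE t.2.1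
        have := length_le_length_rawE gcE t.1
        omega
      omega
    simp only [Polynomial.eval_mul, Polynomial.eval_pow, Polynomial.eval_add, Polynomial.eval_X, Polynomial.eval_ofNat]
    set L := (pairE atE (rawE natE) (t, l₁ ++ l₂)).length with hL
    change K ≤ L + 1 at hKle
    nlinarith

/-- The number of variables on codes. [folklore] -/
theorem numVOf_codeFP : CodeFP atE unE numVOf :=
  unAdd.comp ((stNv.comp stateOf_codeFP).pair ((ulength bitE).comp (snd _ _).fst'))

/-- **The amplitude value on codes**: `(gate codes, y, z) ↦ Γ` is computed by a polynomial-time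
string function. [cite: AaronsonGottesman2004, §III; BravyiGosset2016, App. A–C] -/
theorem ampVal_codeFP : CodeFP atE zgE (fun t => zgOf (ampValOf t)) :=
  (gaussEval_codeFP.comp (numVOf_codeFP.pair ampDataOf_codeFP)).congr fun _ => rfl

/-- **Specification of the coded value**: for a `T`-free oracle-free gate list `U` with `h`
Hadamard gates on `N` wires, `⟨z|U|y⟩ = (1/√2)^h (1/2)^N · ampValOf (codes of U, y, z)`.
[cite: AaronsonGottesman2004, §III] -/
theorem ampValOf_spec {N : ℕ} (gs : List (QGate cliffordT N)) (hgs : ∀ g ∈ gs, g.IsOracleFree)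
    (hT : ∀ g ∈ gs, g.isT = false) (y z : QReg N) :
    (prodZeta omega gs *ᵥ basisState y) z =
      invSqrt2 ^ hCount gs * (1 / 2 : ℂ) ^ N * (ampValOf (gs.map gateTriple, (List.ofFn y, List.ofFn z)) : ℂ) := by
  rw [ampValOf_eq, GData.toComplex_gaussEval, amplitude_eq_gsum gs hgs hT y z, execGates_eq_stateOf gs y (List.ofFn z)]
  unfold numVOf ampDataOf
  simp only [List.length_ofFn]

/-- The number of variables of the task of a gate list. [folklore] -/
theorem numVOf_task {N : ℕ} (gs : List (QGate cliffordT N)) (y z : QReg N) :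
    numVOf (gs.map gateTriple, (List.ofFn y, List.ofFn z)) = hCount gs + N := by
  unfold numVOf
  rw [← execGates_eq_stateOf gs y (List.ofFn z), List.length_ofFn]
  show (SymState.exec (gs.map toSymGate) (SymState.init y)).nv + N = hCount gs + N
  rw [nv_exec_map_toSymGate]; show 0 + hCount gs + N = hCount gs + N; rw [Nat.zero_add]

end Literature.Computability.QuantumComplexity.BravyiGosset

end
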